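import Summits.BirchSwinnertonDyer.BirchSwinnertonDyer.Theorems.ThetaPartnerAtTwoSignedMainConjectureCMTwoRankZeroPTDeepSignedLayerAssembly
import Summits.BirchSwinnertonDyer.BirchSwinnertonDyer.Theorems.ThetaPartnerAtTwoSignedMainConjectureCMTwoRankZeroPTDeepHypLayer
import Summits.BirchSwinnertonDyer.BirchSwinnertonDyer.Theorems.ThetaPartnerAtTwoSignedKatoUpToAtTwoLayerGlobalShapiro
import Literature.NumberTheory.EllipticCurves.CyclotomicLayerTatePairing
import Literature.NumberTheory.EllipticCurves.AnticyclotomicSignedCompactSelmer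
import Literature.NumberTheory.EllipticCurves.H1CorestrictionIndexTwo
import Literature.NumberTheory.EllipticCurves.Sprung2012.ColemanMapLambdaActionProofs
import Literature.NumberTheory.GaloisRepresentations.EulerSystemGaloisAction
import Literature.NumberTheory.GaloisRepresentations.DecompositionGroupOfCompletion
import Summits.BirchSwinnertonDyer.Rank1Residual.GaloisImage.SelmerClassInertia
import HarnessLib

/-!
# Route `ThetaPartnerAtTwo` (TP2), crux K2R0P♭ (stmt-BirchSwinnertonDyer-26471; derived node K2r0P 24945), line `rankzero` v20, stub
# `stub_poitouTateDeepTwo`, hypothesis (T) «transfer» of the `hE` socket — **tools for (T)** (bricks B5c-p / B5c-conv of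
# `Cruxes/SignedMainConjectureCMTwoRankZeroOfPub/PT-DEEP-HALF-DESIGN-w2g4.md` §6/§8)

HONEST FRAMING (cell `pub/bsd-wall`, W-ALL row 1; width seat `bsd-wall-tp2-p2-w2` g4, `--supports` only). THEOREMS ONLY (no definition, no named
fact, no instance, no `sorry`); closes no item; BSD is NOT proved by any of this.

## What is proved
§1 `localTraceOfEmb_smul` — the traces `Tr_{n/m}` are `Γ_E`-equivariant on `E(K_n·E)` (the local layer extension is abelian: commutators of `Γ_E`
   lie in every `Gal(Ē/K_n·E)`, `commutator_mem_localLayerSubgroupOfEmb`); hence **`E^ε(K_n·E)` is `Γ_E`-stable** (`smul_mem_signedLocalPointsOfEmb`).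
§2 the push `E[p^k] ↪ E[p^∞]` on `H¹(H, ·)` (the map `resH1Hom (subgroupInclusion le_rfl) (AddSubgroup.inclusion …)`, no definition introduced):
   `resOfLe_push_eq_zero` (restriction), `conjH1_push` (conjugation) — from `AcSigned.resH1Hom_inclusion_comp_{resOfLe,conjH1}`.
§3 the torsion-level local clauses of the `hE` socket ⟹ the per-place data of `mem_signedSelmerLayer_of_local_data` for the pushed class:
   [bad]/[S] `conjH1_push_mem_localKerOver_of_resOfLe_decomp_eq_zero`, [inf] `conjH1_push_mem_localKerOver_infinitePlace_of_resOfLe_decompInf_eq_zero`,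
   [unr] (the admissibility clause VERBATIM: `∀ 𝔓 ∣ w, resLe … (Γ_n ⊓ I_𝔓 ≤ Γ_n) 1 b = 0`) `resOfLe_kerSubgroup_inertia_conjH1_push_eq_zero` — «unramified» is
   `Γ_K`-stable (`forall_resLe_inf_inertia_conjMap_eq_zero`), `GreenbergSelmer.inertia w = I_{𝔓₀}` for the completion prime
   (`inertia_eq_inertia_adicCompletionPrime`), push, restrict to `Gal(K̄/K_∞)` (`resOfLe_kerSubgroup_inf_eq_zero_of_layer`).
§4 the signed Kummer condition at `v ∣ p`: `kummerWitness_conj_layer`, `conjH1_mem_localKummerOverOfEmb_layer_of_smul_mem` (layer versions of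
   `SignedKatoOffTwo.KummerPoint.kummerWitness_conj` / `conjH1_mem_localKummerOverOfEmb_of_smul_mem`), **`conjH1_mem_localKummerOverOfEmb_signed`**
   (`K = ℚ`, cyclotomic `κ`, `v ∣ p`: ALL conjugates `conj_σ c`, `σ ∈ Γ_ℚ`, satisfy Kobayashi's signed Kummer condition as soon as `c` does — one orbit
   `Γ_ℚ = θ(Γ_v)·Γ_n`, `SignedKatoOffTwo.LayerPairing.forall_exists_inv_mul_mem_layerSubgroup`, and §1), and **[kum] ⟹ (p)**:
   `exists_kummerWitness_push_of_layerLoc_eq_layerKummer` — if `CyclotomicLayer.layerLoc b = CyclotomicLayer.layerKummer Q` then the pushed class has a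
   Kummer witness `(φ, R)` with `p^k R = Q` (the two cocycles differ on `U_n` by a coboundary `τt − t`, `t ∈ A[p^k]`; `R = Q' + ι t` for a root `Q'` of `Q`);
   `push_mem_localKummerOverOfEmb_of_layerLoc_eq_layerKummer`.
The (T) statement itself is the sequel `…PTDeepTransfer.lean`.

References: [Kobayashi2003] Def. 1.1, §2 (p. 4), (8.23) (p. 18); [SilvermanAEC2009] VIII §2; [SerreGaloisCohomology1997] I §2.5; [SerreLocalFields1979] VII §5,
I §7 Prop. 20; [NeukirchANT1999] II §9 Prop. (9.6); [NeukirchSchmidtWingberg2008] I §5; [Washington1997] §13.1; [GreenbergLNM1716] §2.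
-/

set_option autoImplicit false
-- the Theorems namespace of this sub repeats the summit name by design (D-0017 nested layout)
set_option linter.dupNamespace false

noncomputable section

open scoped Classical NumberField Pointwise

universe u

namespace Summit.BirchSwinnertonDyer.BirchSwinnertonDyer.Theorems

namespace SignedLowerOffTwo.PTDeep

open NumberField IsDedekindDomain Field IsDedekindDomain.HeightOneSpectrum
  Literature.NumberTheory.EllipticCurves Literature.NumberTheory.GaloisRepresentations
  Literature.NumberTheory.EllipticCurves.GreenbergSelmer Literature.NumberTheory.EllipticCurves.Kobayashi2003
  Literature.NumberTheory.EllipticCurves.Sprung2012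

/-! ## §1 `E^ε(K_n·E)` is stable under `Γ_E` (the traces are `Γ_E`-equivariant: the local layer extension is abelian) -/

section Trace

variable {K : Type u} [Field K] {p : ℕ} [Fact p.Prime] (κ : ZpExtension K p) {E : Type u} [Field E] [Algebra K E]
  (ι : AlgebraicClosure K →ₐ[K] AlgebraicClosure E) (W : WeierstrassCurve K)

/-- Commutators of `Γ_E` lie in every local layer subgroup `Gal(Ē/K_n·E)` (`κ` takes values in the abelian group `ℤ_p`). [cite: Kobayashi2003, Def. 1.1] -/
theorem commutator_mem_localLayerSubgroupOfEmb (n : ℕ) (d τ : absoluteGaloisGroup E) :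
    τ⁻¹ * d⁻¹ * τ * d ∈ localLayerSubgroupOfEmb κ ι n := by
  rw [mem_localLayerSubgroupOfEmb_iff]
  have h1 : κ (resGalOfEmb ι (τ⁻¹ * d⁻¹ * τ * d)) = 1 := by
    simp only [map_mul, map_inv, mul_assoc]
    rw [mul_comm (κ (resGalOfEmb ι τ)) (κ (resGalOfEmb ι d)), inv_mul_cancel_left, inv_mul_cancel]
  rw [h1, toAdd_one]
  exact dvd_zero _

/-- **The traces `Tr_{n/m}` are `Γ_E`-equivariant on `E(K_n·E)`**: `Tr_{n/m}(d•P) = d • Tr_{n/m} P` (`q.out • d•P = d • q.out • P` because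
`(d q.out)⁻¹ (q.out d)` is a commutator, fixing `P`). [cite: Kobayashi2003, Def. 1.1] -/
theorem localTraceOfEmb_smul (m n : ℕ) (d : absoluteGaloisGroup E) {P : localPoints W E} (hP : P ∈ localLayerPointsOfEmb κ ι W n) :
    localTraceOfEmb κ ι W m n (d • P) = d • localTraceOfEmb κ ι W m n P := by
  haveI := Fintype.ofFinite (localLayerSubgroupOfEmb κ ι m ⧸ (localLayerSubgroupOfEmb κ ι n).subgroupOf (localLayerSubgroupOfEmb κ ι m))
  rw [localTraceOfEmb_apply, localTraceOfEmb_apply, Finset.smul_sum]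
  refine Finset.sum_congr rfl fun q _ ↦ ?_
  rw [smul_smul, smul_smul]
  -- `(q.out * d) • P = (d * q.out) • P`
  set t : absoluteGaloisGroup E := ((q.out : localLayerSubgroupOfEmb κ ι m) : absoluteGaloisGroup E)
  have hfix := (mem_localLayerPointsOfEmb_iff κ ι W n P).mp hP _ (commutator_mem_localLayerSubgroupOfEmb κ ι n d t)
  conv_rhs => rw [← hfix]
  rw [smul_smul]
  congr 1
  group

/-- **`E^ε(K_n·E)` is `Γ_E`-stable.** [cite: Kobayashi2003, Def. 1.1] -/
theorem smul_mem_signedLocalPointsOfEmb (ε : ℤˣ) (n : ℕ) (d : absoluteGaloisGroup E) {P : localPoints W E}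
    (hP : P ∈ signedLocalPointsOfEmb κ ι W ε n) : d • P ∈ signedLocalPointsOfEmb κ ι W ε n := by
  refine ⟨smul_mem_localLayerPointsOfEmb κ ι W n d hP.1, fun m hm hε ↦ ?_⟩
  rw [localTraceOfEmb_smul κ ι W (m + 1) n d hP.1]
  exact smul_mem_localLayerPointsOfEmb κ ι W m d (hP.2 m hm hε)

end Trace

/-! ## §2 The push `E[p^k] ↪ E[p^∞]` on `H¹(Γ_n, ·)`: naturality with restriction and conjugation -/

section Push

variable {K : Type u} [Field K] (W : WeierstrassCurve K) (p : ℕ)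

/-- `res_{H ⊓ D} ∘ push = push ∘ res_{H ⊓ D}` on `H¹(H, E[p^k])`, in the form: `res (push c) = 0` if `res c = 0`. [cite: NeukirchSchmidtWingberg2008, I §5] -/
theorem resOfLe_push_eq_zero {H H' : Subgroup (absoluteGaloisGroup K)} (h : H' ≤ H) (k : ℕ) (c : W.torsionH1Over ((p : ℤ) ^ k) H)
    (hc : resOfLe (W.geomTorsion ((p : ℤ) ^ k)) h c = 0) :
    resOfLe (W.geomPrimaryTorsion p) h
      (resH1Hom (N := W.geomPrimaryTorsion p) (subgroupInclusion (le_refl H))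
        (AddSubgroup.inclusion (AcSigned.geomTorsion_zpow_le_geomPrimaryTorsion W p k)) (fun _ _ ↦ rfl) c) = 0 := by
  have hcomp : (resOfLe (W.geomPrimaryTorsion p) h).comp
      (resH1Hom (N := W.geomPrimaryTorsion p) (subgroupInclusion (le_refl H))
        (AddSubgroup.inclusion (AcSigned.geomTorsion_zpow_le_geomPrimaryTorsion W p k)) (fun _ _ ↦ rfl)) =
      (resH1Hom (N := W.geomPrimaryTorsion p) (subgroupInclusion (le_refl H'))
        (AddSubgroup.inclusion (AcSigned.geomTorsion_zpow_le_geomPrimaryTorsion W p k)) (fun _ _ ↦ rfl)).comp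
      (resOfLe (W.geomTorsion ((p : ℤ) ^ k)) h) := by
    rw [AcSigned.resH1Hom_inclusion_comp_resOfLe W p (le_refl H') h k, resOfLe, resH1Hom_comp]
    exact resH1Hom_congr (ContinuousMonoidHom.ext fun _ ↦ rfl) (AddMonoidHom.ext fun _ ↦ rfl) _ _
  have := congrArg (fun f ↦ f c) hcomp
  simp only [AddMonoidHom.comp_apply] at this
  rw [this, hc, map_zero]

/-- `conj_σ ∘ push = push ∘ conj_σ` on `H¹(H, E[p^k])` (`H` normal). [cite: NeukirchSchmidtWingberg2008, I §5] -/
theorem conjH1_push {H : Subgroup (absoluteGaloisGroup K)} [H.Normal] (k : ℕ) (σ : absoluteGaloisGroup K)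
    (c : W.torsionH1Over ((p : ℤ) ^ k) H) :
    W.conjH1 p H σ (resH1Hom (N := W.geomPrimaryTorsion p) (subgroupInclusion (le_refl H))
        (AddSubgroup.inclusion (AcSigned.geomTorsion_zpow_le_geomPrimaryTorsion W p k)) (fun _ _ ↦ rfl) c) =
      resH1Hom (N := W.geomPrimaryTorsion p) (subgroupInclusion (le_refl H))
        (AddSubgroup.inclusion (AcSigned.geomTorsion_zpow_le_geomPrimaryTorsion W p k)) (fun _ _ ↦ rfl)
        (conjH1 H (W.geomTorsion ((p : ℤ) ^ k)) σ c) := by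
  have h := congrArg (fun f ↦ f c) (AcSigned.resH1Hom_inclusion_comp_conjH1 W p (le_refl H) k σ)
  simp only [AddMonoidHom.comp_apply] at h
  exact h.symm

end Push


/-! ## §3 The torsion-level local data of the `hE` socket ⟹ the per-place data of B5c-core for the pushed class -/

section LocalData

variable {K : Type u} [Field K] [NumberField K] (W : WeierstrassCurve K) (p : ℕ) [Fact p.Prime] (κ : ZpExtension K p)

/-- **[bad]/[S] ⟹ (S)**: if `conj_σ b` vanishes on `Γ_n ⊓ D_w` (`D_w = decomp w`) then `conj_σ (push b)` satisfies the classical local condition at `w`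
over `K_n`. [cite: GreenbergLNM1716, §2] -/
theorem conjH1_push_mem_localKerOver_of_resOfLe_decomp_eq_zero {n k : ℕ} (w : HeightOneSpectrum (𝓞 K))
    (b : W.torsionH1Over ((p : ℤ) ^ k) (κ.layerSubgroup n)) (σ : absoluteGaloisGroup K)
    (hb : resOfLe (W.geomTorsion ((p : ℤ) ^ k)) (inf_le_left : κ.layerSubgroup n ⊓ decomp (K := K) w ≤ κ.layerSubgroup n)
      (conjH1 (κ.layerSubgroup n) (W.geomTorsion ((p : ℤ) ^ k)) σ b) = 0) :
    W.conjH1 p (κ.layerSubgroup n) σ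
        (resH1Hom (N := W.geomPrimaryTorsion p) (subgroupInclusion (le_refl (κ.layerSubgroup n)))
          (AddSubgroup.inclusion (AcSigned.geomTorsion_zpow_le_geomPrimaryTorsion W p k)) (fun _ _ ↦ rfl) b) ∈
      W.localKerOver p (κ.layerSubgroup n) (w.adicCompletion K) := by
  rw [conjH1_push W p k σ b]
  exact Kobayashi2003.mem_localKerOver_of_resOfLe_inf_eq_zero W p (Kobayashi2003.resGalOfEmb_mem_decomp w)
    (resOfLe_push_eq_zero W p inf_le_left k _ hb)

omit [NumberField K] in
/-- **[inf] ⟹ (∞)**: the same at an infinite place `w` (`decompInf w`). [cite: Greenberg1989, §1 p. 98 (3)] -/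
theorem conjH1_push_mem_localKerOver_infinitePlace_of_resOfLe_decompInf_eq_zero {n k : ℕ} (w : InfinitePlace K)
    (b : W.torsionH1Over ((p : ℤ) ^ k) (κ.layerSubgroup n)) (σ : absoluteGaloisGroup K)
    (hb : resOfLe (W.geomTorsion ((p : ℤ) ^ k)) (inf_le_left : κ.layerSubgroup n ⊓ decompInf (K := K) w ≤ κ.layerSubgroup n)
      (conjH1 (κ.layerSubgroup n) (W.geomTorsion ((p : ℤ) ^ k)) σ b) = 0) :
    W.conjH1 p (κ.layerSubgroup n) σ
        (resH1Hom (N := W.geomPrimaryTorsion p) (subgroupInclusion (le_refl (κ.layerSubgroup n)))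
          (AddSubgroup.inclusion (AcSigned.geomTorsion_zpow_le_geomPrimaryTorsion W p k)) (fun _ _ ↦ rfl) b) ∈
      W.localKerOver p (κ.layerSubgroup n) w.Completion := by
  rw [conjH1_push W p k σ b]
  exact Kobayashi2003.mem_localKerOver_of_resOfLe_inf_eq_zero W p (Kobayashi2003.resGalOfEmb_mem_decompInf w)
    (resOfLe_push_eq_zero W p inf_le_left k _ hb)

/-- `GreenbergSelmer.inertia w` is the inertia group of the prime `𝔓₀ = adicCompletionPrime K w` of `\bar ℤ_K`. [cite: NeukirchANT1999, Ch. II §9 Prop. (9.6)] -/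
theorem inertia_eq_inertia_adicCompletionPrime (w : HeightOneSpectrum (𝓞 K)) :
    GreenbergSelmer.inertia (K := K) w = (adicCompletionPrime K w).inertia (absoluteGaloisGroup K) := by
  rw [inertia_adicCompletionPrime_eq_map_absInertia K w]
  rfl

/-- **[unr] ⟹ (ur)**: if `b ∈ H¹(Γ_n, E[p^k])` vanishes on `Γ_n ⊓ I_𝔓` for every prime `𝔓 ∣ w` of `\bar ℤ_K` (the admissibility clause of `hE`), then for
every `σ ∈ Γ_K` the class `conj_σ (h_n (push b)) ∈ H¹(K_∞, E[p^∞])` vanishes on `Gal(K̄/K_∞) ⊓ I_w` (`I_w = GreenbergSelmer.inertia w`): «unramified» is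
`Γ_K`-stable (`forall_resLe_inf_inertia_conjMap_eq_zero`), `I_w = I_{𝔓₀}` for the completion prime, push and restrict.
[cite: SerreLocalFields1979, VII §5 and I §7 Prop. 20] [cite: NeukirchANT1999, Ch. II §9 Prop. (9.6)] -/
theorem resOfLe_kerSubgroup_inertia_conjH1_push_eq_zero {n k : ℕ} (w : HeightOneSpectrum (𝓞 K))
    (b : W.torsionH1Over ((p : ℤ) ^ k) (κ.layerSubgroup n))
    (hb : ∀ 𝔓 ∈ w.primesAbove, resLe (W.torsionGaloisModule ((p : ℤ) ^ k)).toTopRep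
      (inf_le_left : κ.layerSubgroup n ⊓ 𝔓.inertia (absoluteGaloisGroup K) ≤ κ.layerSubgroup n) 1 b = 0)
    (σ : absoluteGaloisGroup K) :
    resOfLe (W.geomPrimaryTorsion p) (inf_le_left : κ.kerSubgroup ⊓ GreenbergSelmer.inertia (K := K) w ≤ κ.kerSubgroup)
      (W.conjH1 p κ.kerSubgroup σ (W.layerToInfty κ n
        (resH1Hom (N := W.geomPrimaryTorsion p) (subgroupInclusion (le_refl (κ.layerSubgroup n)))
          (AddSubgroup.inclusion (AcSigned.geomTorsion_zpow_le_geomPrimaryTorsion W p k)) (fun _ _ ↦ rfl) b))) = 0 := by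
  -- `conj_σ b` vanishes on `Γ_n ⊓ I_{𝔓₀}`
  have h1 := forall_resLe_inf_inertia_conjMap_eq_zero (W.torsionGaloisModule ((p : ℤ) ^ k)).toTopRep (κ.layerSubgroup n) w σ hb
    (adicCompletionPrime K w) (adicCompletionPrime_mem_primesAbove K w)
  -- in the `resOfLe`/`conjH1` dialect and at `GreenbergSelmer.inertia w`
  have h2 : resOfLe (W.geomTorsion ((p : ℤ) ^ k)) (inf_le_left : κ.layerSubgroup n ⊓ GreenbergSelmer.inertia (K := K) w ≤ κ.layerSubgroup n)
      (conjH1 (κ.layerSubgroup n) (W.geomTorsion ((p : ℤ) ^ k)) σ b) = 0 :=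
    resOfLe_eq_zero_congr (W.geomTorsion ((p : ℤ) ^ k)) (by rw [inertia_eq_inertia_adicCompletionPrime]) _ _ h1
  refine resOfLe_kerSubgroup_inf_eq_zero_of_layer κ W (GreenbergSelmer.inertia (K := K) w) _ σ ?_
  rw [conjH1_push W p k σ b]
  exact resOfLe_push_eq_zero W p inf_le_left k _ h2

end LocalData


/-! ## §4 The signed Kummer condition at `v ∣ p`: conjugation (all places above `v` — one orbit) and the [kum] clause -/

section KummerConj

variable {K : Type u} [Field K] (W : WeierstrassCurve K) (p : ℕ) [Fact p.Prime] (κ : ZpExtension K p)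
  {E : Type u} [Field E] [Algebra K E] (ι : AlgebraicClosure K →ₐ[K] AlgebraicClosure E)

/-- **The conjugate of a layer Kummer witness** (`H = Γ_n`; cf. `SignedKatoOffTwo.KummerPoint.kummerWitness_conj` for `H = Gal(K̄/K_∞)`): if
`ι(φ(res τ)) = τQ − Q` on `Gal(Ē/K_n·E)` then `ι((res σ · φ)(res τ)) = τ(σQ) − σQ`. [cite: SerreGaloisCohomology1997, I §2.5] [cite: Kobayashi2003, §2 p. 4] -/
theorem kummerWitness_conj_layer (n : ℕ) (σ : absoluteGaloisGroup E)
    {φ : contOneCocycles (discreteTopRep (κ.layerSubgroup n) (W.geomPrimaryTorsion p))} {Q : localPoints W E}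
    (hτ : ∀ τ : localSubgroupOfEmb (κ.layerSubgroup n) ι,
      pointsMapOfEmb W ι ((φ.1 (resGalSubgroupOfEmb (κ.layerSubgroup n) ι τ) : W.geomPrimaryTorsion p) : W.geomPoints) =
        (τ : absoluteGaloisGroup E) • Q - Q)
    (τ : localSubgroupOfEmb (κ.layerSubgroup n) ι) :
    pointsMapOfEmb W ι (((conjCocycle (κ.layerSubgroup n) (resGalOfEmb ι σ) φ).1 (resGalSubgroupOfEmb (κ.layerSubgroup n) ι τ) :
        W.geomPrimaryTorsion p) : W.geomPoints) =
      (τ : absoluteGaloisGroup E) • (σ • Q) - σ • Q := by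
  have hτ' : σ⁻¹ * (τ : absoluteGaloisGroup E) * σ ∈ localSubgroupOfEmb (κ.layerSubgroup n) ι := by
    rw [mem_localSubgroupOfEmb_iff, map_mul, map_mul, map_inv]
    exact (κ.layerSubgroup_normal n).conj_mem' _ ((mem_localSubgroupOfEmb_iff (κ.layerSubgroup n) ι _).1 τ.2) _
  have hconj : subgroupConj (κ.layerSubgroup n) (resGalOfEmb ι σ) (resGalSubgroupOfEmb (κ.layerSubgroup n) ι τ) =
      resGalSubgroupOfEmb (κ.layerSubgroup n) ι ⟨σ⁻¹ * (τ : absoluteGaloisGroup E) * σ, hτ'⟩ := by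
    apply Subtype.ext
    rw [subgroupConj_apply_coe, resGalSubgroupOfEmb_apply_coe, resGalSubgroupOfEmb_apply_coe, map_mul, map_mul, map_inv]
  rw [conjCocycle_apply, hconj, primaryComponent.coe_smul, pointsMapOfEmb_smul, hτ ⟨_, hτ'⟩, smul_sub, smul_smul, smul_smul]
  congr 1
  rw [show σ * (σ⁻¹ * (τ : absoluteGaloisGroup E) * σ) = (τ : absoluteGaloisGroup E) * σ by group, mul_smul]

/-- **`Kummer(A)` at the layer is stable under `conj_{res σ}`** for `σ ∈ Γ_E` with `σ • A ⊆ A`. [cite: SerreGaloisCohomology1997, I §2.5] [cite: Kobayashi2003, Def. 1.1] -/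
theorem conjH1_mem_localKummerOverOfEmb_layer_of_smul_mem (n : ℕ) (B : AddSubgroup (localPoints W E))
    (σ : absoluteGaloisGroup E) (hB : ∀ a ∈ B, σ • a ∈ B) {c : W.subgroupH1 p (κ.layerSubgroup n)}
    (hc : c ∈ localKummerOverOfEmb W p (κ.layerSubgroup n) ι B) :
    W.conjH1 p (κ.layerSubgroup n) (resGalOfEmb ι σ) c ∈ localKummerOverOfEmb W p (κ.layerSubgroup n) ι B := by
  obtain ⟨φ, Q, k, rfl, hQ, hτ⟩ := hc
  refine ⟨conjCocycle (κ.layerSubgroup n) (resGalOfEmb ι σ) φ, σ • Q, k, ?_, ?_, kummerWitness_conj_layer W p κ ι n σ hτ⟩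
  · exact (conjH1_oneCocycleClass (κ.layerSubgroup n) (resGalOfEmb ι σ) φ).symm
  · rw [smul_comm]; exact hB _ hQ

end KummerConj

section KummerRat

variable (A : WeierstrassCurve ℚ) [A.IsElliptic] {p : ℕ} [Fact p.Prime] (κ : ZpExtension ℚ p) (v : HeightOneSpectrum (𝓞 ℚ))

omit [A.IsElliptic] in
/-- **All places above `v ∣ p` at once (one orbit: `Γ_ℚ = θ(Γ_v)·Γ_n` for the cyclotomic tower)**: if `c ∈ H¹(Γ_n, A[p^∞])` satisfies Kobayashi's signed
Kummer condition at the chosen place above `v`, then so does every conjugate `conj_σ c`, `σ ∈ Γ_ℚ` (`σ = θ(d)·u`, `u ∈ Γ_n` acts trivially,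
`θ(d)` preserves the condition because `E^ε(ℚ_n·ℚ_v)` is `Γ_v`-stable). [cite: Kobayashi2003, Def. 1.1, §2 p. 4] [cite: Washington1997, §13.1] -/
theorem conjH1_mem_localKummerOverOfEmb_signed (hκ : κ.IsCyclotomic) (hv : (p : 𝓞 ℚ) ∈ v.asIdeal) (ε : ℤˣ) (n : ℕ)
    {c : A.subgroupH1 p (κ.layerSubgroup n)}
    (hc : c ∈ localKummerOverOfEmb A p (κ.layerSubgroup n) (closureEmb (K := ℚ) (v.adicCompletion ℚ))
      (signedLocalPoints κ (v.adicCompletion ℚ) A ε n)) (σ : absoluteGaloisGroup ℚ) :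
    A.conjH1 p (κ.layerSubgroup n) σ c ∈ localKummerOverOfEmb A p (κ.layerSubgroup n) (closureEmb (K := ℚ) (v.adicCompletion ℚ))
      (signedLocalPoints κ (v.adicCompletion ℚ) A ε n) := by
  obtain ⟨d, hd⟩ := SignedKatoOffTwo.LayerPairing.forall_exists_inv_mul_mem_layerSubgroup κ v hκ hv n σ
  have hσ : σ = resGalOfEmb (closureEmb (K := ℚ) (v.adicCompletion ℚ)) d *
      ((resGalOfEmb (closureEmb (K := ℚ) (v.adicCompletion ℚ)) d)⁻¹ * σ) := by rw [mul_inv_cancel_left]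
  rw [hσ, A.conjH1_mul_holds p (κ.layerSubgroup n), AddMonoidHom.comp_apply, A.conjH1_of_mem_holds p (κ.layerSubgroup n) hd,
    AddMonoidHom.id_apply]
  exact conjH1_mem_localKummerOverOfEmb_layer_of_smul_mem A p κ (closureEmb (K := ℚ) (v.adicCompletion ℚ)) n _ d
    (fun a ha ↦ smul_mem_signedLocalPointsOfEmb κ _ A ε n d ha) hc

/-- **[kum] ⟹ (p)**: if the localisation of `b ∈ H¹(Γ_n, A[N])` (`N = p^k`) at the layer is the layer Kummer class of `Q ∈ E(ℚ_{n,v})`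
(`CyclotomicLayer.layerLoc b = CyclotomicLayer.layerKummer Q`), then the pushed class `push b ∈ H¹(Γ_n, A[p^∞])` satisfies Kobayashi's Kummer condition
for every `B ∋ Q`: the two cocycles differ on `U_n` by a coboundary `τ t − t`, `t ∈ A[N]`, and `(β, Q' + ι t, k)` with `N Q' = Q` is a Kummer witness
(`p^k (Q' + ι t) = Q`). [cite: Kobayashi2003, Def. 1.1, (8.23) (p. 18)] [cite: SilvermanAEC2009, VIII §2] -/
theorem exists_kummerWitness_push_of_layerLoc_eq_layerKummer (n k : ℕ) [NeZero (p ^ k)]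
    (b : A.torsionH1Over ((p : ℤ) ^ k) (κ.layerSubgroup n)) (Q : localPoints A (v.adicCompletion ℚ))
    (hQn : Q ∈ localLayerPointsOfEmb κ (closureEmb (K := ℚ) (v.adicCompletion ℚ)) A n)
    (hkum : CyclotomicLayer.layerLoc A (p ^ k) κ v n b = CyclotomicLayer.layerKummer A (p ^ k) κ v n ⟨Q, hQn⟩) :
    ∃ (φ : contOneCocycles (discreteTopRep (κ.layerSubgroup n) (A.geomPrimaryTorsion p))) (R : localPoints A (v.adicCompletion ℚ)),
      oneCocycleClass _ φ = resH1Hom (N := A.geomPrimaryTorsion p) (subgroupInclusion (le_refl (κ.layerSubgroup n)))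
        (AddSubgroup.inclusion (AcSigned.geomTorsion_zpow_le_geomPrimaryTorsion A p k)) (fun _ _ ↦ rfl) b ∧
      (p ^ k) • R = Q ∧
      ∀ τ : localSubgroupOfEmb (κ.layerSubgroup n) (closureEmb (K := ℚ) (v.adicCompletion ℚ)),
        pointsMapOfEmb A (closureEmb (K := ℚ) (v.adicCompletion ℚ))
            ((φ.1 (resGalSubgroupOfEmb (κ.layerSubgroup n) _ τ) : A.geomPrimaryTorsion p) : A.geomPoints) =
          (τ : absoluteGaloisGroup (v.adicCompletion ℚ)) • R - R := by
  set ι := closureEmb (K := ℚ) (v.adicCompletion ℚ) with hι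
  have hN : (((p ^ k : ℕ) : ℤ)) ≠ 0 := by exact_mod_cast NeZero.ne (p ^ k)
  -- a cocycle `β` of `b` and a root `Q'` of `Q`
  obtain ⟨β, rfl⟩ := oneCocycleClass_surjective (discreteTopRep (κ.layerSubgroup n) (A.geomTorsion ((p : ℤ) ^ k))) b
  set Q' : localPoints A (v.adicCompletion ℚ) := A.subgroupZSMulRoot ((p ^ k : ℕ) : ℤ) hN Q with hQ'
  have hR : ((p ^ k : ℕ) : ℤ) • Q' = Q := A.zsmul_subgroupZSMulRoot _ hN Q
  have hfix : ((p ^ k : ℕ) : ℤ) • Q' ∈ FixedPoints.addSubgroup (CyclotomicLayer.layerGroup κ v n) (localPoints A (v.adicCompletion ℚ)) := by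
    rw [hR]; exact hQn
  -- [kum] at the level of cocycles: `β ∘ res` and the Kummer cocycle of `Q'` differ by a coboundary
  have hK : CyclotomicLayer.layerKummer A (p ^ k) κ v n ⟨Q, hQn⟩ =
      oneCocycleClass _ (A.subgroupKummerCocycle ((p ^ k : ℕ) : ℤ) (CyclotomicLayer.layerGroup κ v n) hN Q' hfix) := by
    change A.subgroupKummerMap ((p ^ k : ℕ) : ℤ) (CyclotomicLayer.layerGroup κ v n) hN ⟨Q, hQn⟩ = _
    rw [A.subgroupKummerMap_apply_eq _ _ hN ⟨Q, hQn⟩ Q' hfix hR]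
    rfl
  have hL : CyclotomicLayer.layerLoc A (p ^ k) κ v n (oneCocycleClass (discreteTopRep (κ.layerSubgroup n) (A.geomTorsion ((p : ℤ) ^ k))) β) =
      oneCocycleClass (subgroupRep (CyclotomicLayer.torsionLocalRep A (p ^ k) v) (CyclotomicLayer.layerGroup κ v n))
        (contOneCocycles.pullback (resGalSubgroupOfEmb (κ.layerSubgroup n) ι)
        (X := subgroupRep (A.torsionGaloisModule ((p ^ k : ℕ) : ℤ)).toTopRep (κ.layerSubgroup n))
        (Y := subgroupRep (CyclotomicLayer.torsionLocalRep A (p ^ k) v) (CyclotomicLayer.layerGroup κ v n))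
        (TopRep.ofHom ⟨ContinuousLinearMap.id ℤ (A.geomTorsion ((p ^ k : ℕ) : ℤ)), fun _ => rfl⟩) β) :=
    map_oneCocycleClass _ _ _ β
  rw [hL, hK, ← sub_eq_zero, ← oneCocycleClass_sub, oneCocycleClass_eq_zero_iff] at hkum
  obtain ⟨t, ht⟩ := hkum
  have hR' : (p ^ k) • Q' = Q := by rw [← natCast_zsmul]; exact hR
  -- the values: `ι(β(res τ)) = (τQ' − Q') + (τ•ιt − ιt)`
  have hval : ∀ τ : CyclotomicLayer.layerGroup κ v n,
      pointsMapOfEmb A ι ((β.1 (resGalSubgroupOfEmb (κ.layerSubgroup n) ι τ) : A.geomTorsion ((p : ℤ) ^ k)) : A.geomPoints) =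
        (τ : absoluteGaloisGroup (v.adicCompletion ℚ)) • (Q' + pointsMapOfEmb A ι ((t : A.geomTorsion ((p ^ k : ℕ) : ℤ)) : A.geomPoints)) -
          (Q' + pointsMapOfEmb A ι ((t : A.geomTorsion ((p ^ k : ℕ) : ℤ)) : A.geomPoints)) := by
    intro τ
    -- the Kummer cocycle and the action, read on points of `E(ℚ̄_v)`
    have hkum' : pointsMapOfEmb A ι (((A.subgroupKummerCocycle ((p ^ k : ℕ) : ℤ) (CyclotomicLayer.layerGroup κ v n) hN Q' hfix).1 τ :
        A.geomTorsion ((p ^ k : ℕ) : ℤ)) : A.geomPoints) = (τ : absoluteGaloisGroup (v.adicCompletion ℚ)) • Q' - Q' :=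
      A.pointsMap_subgroupKummerCocycle_apply _ _ hN Q' hfix τ
    have hρ : pointsMapOfEmb A ι ((((subgroupRep (CyclotomicLayer.torsionLocalRep A (p ^ k) v) (CyclotomicLayer.layerGroup κ v n)).ρ τ t :
        A.geomTorsion ((p ^ k : ℕ) : ℤ)) : A.geomPoints)) =
          (τ : absoluteGaloisGroup (v.adicCompletion ℚ)) • pointsMapOfEmb A ι ((t : A.geomTorsion ((p ^ k : ℕ) : ℤ)) : A.geomPoints) := by
      rw [← pointsMapOfEmb_smul]
      rfl
    -- the coboundary identity at `τ`, mapped to `E(ℚ̄_v)`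
    have e1 : ((contOneCocycles.pullback (resGalSubgroupOfEmb (κ.layerSubgroup n) ι)
          (X := subgroupRep (A.torsionGaloisModule ((p ^ k : ℕ) : ℤ)).toTopRep (κ.layerSubgroup n))
          (Y := subgroupRep (CyclotomicLayer.torsionLocalRep A (p ^ k) v) (CyclotomicLayer.layerGroup κ v n))
          (TopRep.ofHom ⟨ContinuousLinearMap.id ℤ (A.geomTorsion ((p ^ k : ℕ) : ℤ)), fun _ => rfl⟩) β -
          A.subgroupKummerCocycle ((p ^ k : ℕ) : ℤ) (CyclotomicLayer.layerGroup κ v n) hN Q' hfix).1 τ : A.geomTorsion ((p ^ k : ℕ) : ℤ)) =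
        @id (A.geomTorsion ((p ^ k : ℕ) : ℤ)) (β.1 (resGalSubgroupOfEmb (κ.layerSubgroup n) ι τ)) -
          @id (A.geomTorsion ((p ^ k : ℕ) : ℤ)) ((A.subgroupKummerCocycle ((p ^ k : ℕ) : ℤ) (CyclotomicLayer.layerGroup κ v n) hN Q' hfix).1 τ) :=
      rfl
    have h := ht τ
    rw [e1] at h
    have h3 := congrArg (fun x : A.geomTorsion ((p ^ k : ℕ) : ℤ) ↦ pointsMapOfEmb A ι (x : A.geomPoints)) h
    simp only [AddSubgroupClass.coe_sub, map_sub] at h3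
    refine (eq_add_of_sub_eq h3).trans ?_
    show pointsMapOfEmb A ι ((((subgroupRep (CyclotomicLayer.torsionLocalRep A (p ^ k) v) (CyclotomicLayer.layerGroup κ v n)).ρ τ t :
        A.geomTorsion ((p ^ k : ℕ) : ℤ)) : A.geomPoints)) - pointsMapOfEmb A ι ((t : A.geomTorsion ((p ^ k : ℕ) : ℤ)) : A.geomPoints) +
        pointsMapOfEmb A ι (((A.subgroupKummerCocycle ((p ^ k : ℕ) : ℤ) (CyclotomicLayer.layerGroup κ v n) hN Q' hfix).1 τ :
          A.geomTorsion ((p ^ k : ℕ) : ℤ)) : A.geomPoints) = _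
    rw [hρ, hkum', smul_add]
    abel
  refine ⟨contOneCocycles.pullback (subgroupInclusion (le_refl (κ.layerSubgroup n)))
      (resHomOfEquivariant (subgroupInclusion (le_refl (κ.layerSubgroup n)))
        (AddSubgroup.inclusion (AcSigned.geomTorsion_zpow_le_geomPrimaryTorsion A p k)) fun _ _ ↦ rfl) β,
    Q' + pointsMapOfEmb A ι ((t : A.geomTorsion ((p ^ k : ℕ) : ℤ)) : A.geomPoints), ?_, ?_, fun τ ↦ ?_⟩
  · exact (resH1Hom_oneCocycleClass _ _ _ β).symm
  · -- `p^k • (Q' + ι t) = Q`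
    have ht0 : (p ^ k) • ((t : A.geomTorsion ((p ^ k : ℕ) : ℤ)) : A.geomPoints) = 0 := by
      have h := (WeierstrassCurve.mem_geomTorsion_iff A _ ((t : A.geomTorsion ((p ^ k : ℕ) : ℤ)) : A.geomPoints)).1 t.2
      rwa [natCast_zsmul] at h
    rw [smul_add, hR', ← map_nsmul, ht0, map_zero, add_zero]
  · rw [contOneCocycles.pullback_apply]
    exact hval τ

/-- **[kum] ⟹ (p) at the chosen place**: under `layerLoc b = layerKummer Q`, the pushed class satisfies Kobayashi's Kummer condition for every `B ∋ Q`.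
[cite: Kobayashi2003, Def. 1.1] -/
theorem push_mem_localKummerOverOfEmb_of_layerLoc_eq_layerKummer (n k : ℕ) [NeZero (p ^ k)]
    (b : A.torsionH1Over ((p : ℤ) ^ k) (κ.layerSubgroup n)) (Q : localPoints A (v.adicCompletion ℚ))
    (hQn : Q ∈ localLayerPointsOfEmb κ (closureEmb (K := ℚ) (v.adicCompletion ℚ)) A n)
    (hkum : CyclotomicLayer.layerLoc A (p ^ k) κ v n b = CyclotomicLayer.layerKummer A (p ^ k) κ v n ⟨Q, hQn⟩)
    (B : AddSubgroup (localPoints A (v.adicCompletion ℚ))) (hQB : Q ∈ B) :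
    resH1Hom (N := A.geomPrimaryTorsion p) (subgroupInclusion (le_refl (κ.layerSubgroup n)))
        (AddSubgroup.inclusion (AcSigned.geomTorsion_zpow_le_geomPrimaryTorsion A p k)) (fun _ _ ↦ rfl) b ∈
      localKummerOverOfEmb A p (κ.layerSubgroup n) (closureEmb (K := ℚ) (v.adicCompletion ℚ)) B := by
  obtain ⟨φ, R, hφ, hR, hloc⟩ := exists_kummerWitness_push_of_layerLoc_eq_layerKummer A κ v n k b Q hQn hkum
  exact ⟨φ, R, k, hφ, by rw [hR]; exact hQB, hloc⟩

end KummerRat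

end SignedLowerOffTwo.PTDeep

end Summit.BirchSwinnertonDyer.BirchSwinnertonDyer.Theorems

end
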